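import Mathlib
import Summits.NavierStokesRegularity.NavierStokesRegularity.Theorems.EulerZoomLiouvillePowerGaugeEulerLiouvillePressureSplitSlice
import HarnessLib

/-!
# The pressure × velocity bound on a ball over a time window, by the local pressure splitting
# (crux `EulerZoomLiouville.PowerGaugeEulerLiouville` = stmt-NavierStokesRegularity-19832, lead's line `birth`)

Route `EulerZoomLiouville` (NavierStokesRegularity).  Second brick of the sharper pressure route (first brick:
`…PressureSplitSlice.lean`, one time slice).  Here the slice bound is integrated over a time window for a
distributional Euler/Navier–Stokes solution on the ancient slab, slicing the pressure equation with the tree's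
`IsDistributionalNSSolutionOn.ae_forall_slice_pressure_identity`:

* `exists_lintegral_pressure_velocity_window_le_split` — an absolute `c` with: for a distributional solution
  `(u,p)` (no force, any viscosity) on `(−∞,0) × ℝ³`, a radius `r > 0`, a window `α < β ≤ 0`, and a bound `S` of
  the velocity `L¹` masses `∫_{B_{r/2}} |u(t)|` (`t ∈ (α,β)`):
  `∫∫_{(α,β)×B_{r/2}} |p||u| ≤ c · [ I_u + r⁻³ S (I_p + r (β−α)^{1/3} I_u^{2/3}) ]`,
  `I_u = ∫∫_{(α,β)×B_r}|u|³`, `I_p = ∫∫_{(α,β)×B_r}|p|` (provided `∫∫|p|^{3/2}, I_u < ∞` on `(α,β) × B_r`).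
  The first term is the CUBIC rate; no `D`-gauge power `(∫∫|p|^{3/2})^{2/3}` multiplies `I_u^{1/3}` any more.

With the gauges (`S ~ a^{2−ρ}`, `I_p ≲ a^{7/3−4ρ/3}`, `I_u ≲ a^{3/2−9ρ/4}` at `r = 2a`) this yields the one-ball
flux mass `≲ a^{3/2−9ρ/4}` and window flux integrability for `ρ > 2/9` (third brick).  WHAT THIS IS NOT: not NS,
not the open core; a helper `--supports` stmt-19832. [folklore]
-/

noncomputable section

set_option linter.dupNamespace false

open MeasureTheory Set Filter Topology Metric Function TopologicalSpace
open scoped ENNReal NNReal ContDiff Laplacian InnerProductSpace RealInnerProductSpace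

namespace Summit.NavierStokesRegularity.NavierStokesRegularity.Theorems.PowerGaugeEulerLiouville

open Literature.Analysis Literature.Analysis.FunctionSpaces Literature.Analysis.FluidPDE

-- nested operator types (curried second derivatives)
set_option maxSynthPendingDepth 3 in
/-- **Pressure × velocity on a ball over a time window** (see the file docstring): there is an absolute `c` with
`∫∫_{(α,β)×B_{r/2}} |p||u| ≤ c (I_u + (r³)⁻¹ S (I_p + r (β−α)^{1/3} I_u^{2/3}))` for every distributional solution
on the ancient slab, `0 < r`, `α < β ≤ 0`, `∫_{B_{r/2}}|u(t)| ≤ S` on the window, and finite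
`∫∫_{(α,β)×B_r}|p|^{3/2}`, `I_u`.  Slice-wise `…PressureSplitSlice` + Tonelli + Hölder in time. [folklore] -/
theorem exists_lintegral_pressure_velocity_window_le_split :
    ∃ c : ℝ≥0, ∀ (ν : ℝ) (u : ℝ → EuclideanSpace ℝ (Fin 3) → EuclideanSpace ℝ (Fin 3))
      (p : ℝ → EuclideanSpace ℝ (Fin 3) → ℝ) (r α β : ℝ) (S : ℝ≥0∞), 0 < r → α < β → β ≤ 0 →
      IsDistributionalNSSolutionOn (slab (EuclideanSpace ℝ (Fin 3)) (Iio 0) isOpen_Iio) ν 0 u p →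
      (∀ t ∈ Ioo α β, ∫⁻ x in ball (0 : EuclideanSpace ℝ (Fin 3)) (r / 2), ‖u t x‖ₑ ≤ S) →
      ∫⁻ z in Ioo α β ×ˢ ball (0 : EuclideanSpace ℝ (Fin 3)) r, ‖p z.1 z.2‖ₑ ^ (3 / 2 : ℝ) < ⊤ →
      ∫⁻ z in Ioo α β ×ˢ ball (0 : EuclideanSpace ℝ (Fin 3)) r, ‖u z.1 z.2‖ₑ ^ (3 : ℕ) < ⊤ →
      ∫⁻ z in Ioo α β ×ˢ ball (0 : EuclideanSpace ℝ (Fin 3)) (r / 2), ‖p z.1 z.2‖ₑ * ‖u z.1 z.2‖ₑ ≤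
        c * ((∫⁻ z in Ioo α β ×ˢ ball (0 : EuclideanSpace ℝ (Fin 3)) r, ‖u z.1 z.2‖ₑ ^ (3 : ℕ)) +
          ENNReal.ofReal ((r ^ 3)⁻¹) * S *
            ((∫⁻ z in Ioo α β ×ˢ ball (0 : EuclideanSpace ℝ (Fin 3)) r, ‖p z.1 z.2‖ₑ) +
              ENNReal.ofReal r * ENNReal.ofReal (β - α) ^ (1 / 3 : ℝ) *
                (∫⁻ z in Ioo α β ×ˢ ball (0 : EuclideanSpace ℝ (Fin 3)) r, ‖u z.1 z.2‖ₑ ^ (3 : ℕ)) ^ (2 / 3 : ℝ))) := by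
  obtain ⟨c₄, hc₄⟩ := exists_setLIntegral_pressure_velocity_ball_le
  refine ⟨c₄, fun ν u p r α β S hr hαβ hβ hns hS hIpt hIut => ?_⟩
  -- restrict the solution to the cylinder `(α,β) × B_r`
  set Ω : Opens (EuclideanSpace ℝ (Fin 3)) := ⟨ball (0 : EuclideanSpace ℝ (Fin 3)) r, isOpen_ball⟩ with hΩ
  set Qc : Opens (ℝ × EuclideanSpace ℝ (Fin 3)) :=
    ⟨Ioo α β ×ˢ (Ω : Set (EuclideanSpace ℝ (Fin 3))), isOpen_Ioo.prod Ω.isOpen⟩ with hQc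
  have hQle : Qc ≤ slab (EuclideanSpace ℝ (Fin 3)) (Iio 0) isOpen_Iio := by
    intro w hw
    rw [mem_slab]
    exact lt_of_lt_of_le (mem_prod.1 hw).1.2 hβ
  have hns' : IsDistributionalNSSolutionOn Qc ν 0 u p := hns.of_le hQle
  have hf0 : LocallyIntegrableOn
      (uncurry (0 : ℝ → EuclideanSpace ℝ (Fin 3) → EuclideanSpace ℝ (Fin 3)))
      (Ioo α β ×ˢ (Ω : Set (EuclideanSpace ℝ (Fin 3)))) volume :=
    locallyIntegrableOn_const _
  have hdiv0 : ∀ φ : ℝ → EuclideanSpace ℝ (Fin 3) → ℝ,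
      IsSpaceTimeTestOn Qc φ →
      ∫ q in Ioo α β ×ˢ (Ω : Set (EuclideanSpace ℝ (Fin 3))),
        ⟪(0 : ℝ → EuclideanSpace ℝ (Fin 3) → EuclideanSpace ℝ (Fin 3)) q.1 q.2,
          gradient (φ q.1) q.2⟫ = 0 := fun φ _ => by simp
  -- Tonelli data
  set μt : Measure ℝ := volume.restrict (Ioo α β) with hμt
  set μx : Measure (EuclideanSpace ℝ (Fin 3)) := volume.restrict (ball (0 : EuclideanSpace ℝ (Fin 3)) r) with hμx
  set μy : Measure (EuclideanSpace ℝ (Fin 3)) :=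
    volume.restrict (ball (0 : EuclideanSpace ℝ (Fin 3)) (r / 2)) with hμy
  have hprod : μt.prod μx = volume.restrict (Ioo α β ×ˢ ball (0 : EuclideanSpace ℝ (Fin 3)) r) := by
    rw [hμt, hμx, Measure.prod_restrict, ← Measure.volume_eq_prod]
  have hprody : μt.prod μy = volume.restrict (Ioo α β ×ˢ ball (0 : EuclideanSpace ℝ (Fin 3)) (r / 2)) := by
    rw [hμt, hμy, Measure.prod_restrict, ← Measure.volume_eq_prod]
  have hsuby : Ioo α β ×ˢ ball (0 : EuclideanSpace ℝ (Fin 3)) (r / 2) ⊆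
      Ioo α β ×ˢ ball (0 : EuclideanSpace ℝ (Fin 3)) r :=
    prod_mono Subset.rfl (ball_subset_ball (by linarith))
  have hpm : AEStronglyMeasurable (uncurry p) (μt.prod μx) := by
    rw [hprod]; exact hns'.2.2.1.aestronglyMeasurable
  have hum : AEStronglyMeasurable (uncurry u) (μt.prod μx) := by
    rw [hprod]; exact hns'.1.aestronglyMeasurable
  have hpmy : AEStronglyMeasurable (uncurry p) (μt.prod μy) := by
    rw [hprody]; rw [hprod] at hpm; exact hpm.mono_measure (Measure.restrict_mono hsuby le_rfl)
  have humy : AEStronglyMeasurable (uncurry u) (μt.prod μy) := by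
    rw [hprody]; rw [hprod] at hum; exact hum.mono_measure (Measure.restrict_mono hsuby le_rfl)
  have hGp : AEMeasurable (fun q : ℝ × EuclideanSpace ℝ (Fin 3) => ‖p q.1 q.2‖ₑ ^ (3 / 2 : ℝ))
      (μt.prod μx) := hpm.enorm.pow_const _
  have hGp1 : AEMeasurable (fun q : ℝ × EuclideanSpace ℝ (Fin 3) => ‖p q.1 q.2‖ₑ) (μt.prod μx) := hpm.enorm
  have hGu : AEMeasurable (fun q : ℝ × EuclideanSpace ℝ (Fin 3) => ‖u q.1 q.2‖ₑ ^ (3 : ℕ))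
      (μt.prod μx) := hum.enorm.pow_const _
  have hGpu : AEMeasurable (fun q : ℝ × EuclideanSpace ℝ (Fin 3) => ‖p q.1 q.2‖ₑ * ‖u q.1 q.2‖ₑ)
      (μt.prod μy) := hpmy.enorm.mul humy.enorm
  set Ip : ℝ≥0∞ := ∫⁻ z in Ioo α β ×ˢ ball (0 : EuclideanSpace ℝ (Fin 3)) r, ‖p z.1 z.2‖ₑ with hIp
  set Iu : ℝ≥0∞ := ∫⁻ z in Ioo α β ×ˢ ball (0 : EuclideanSpace ℝ (Fin 3)) r, ‖u z.1 z.2‖ₑ ^ (3 : ℕ) with hIu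
  have hIp_it : Ip = ∫⁻ t, ∫⁻ x, ‖p t x‖ₑ ∂μx ∂μt := by
    rw [hIp, ← hprod, lintegral_prod _ hGp1]
  have hIu_it : Iu = ∫⁻ t, ∫⁻ x, ‖u t x‖ₑ ^ (3 : ℕ) ∂μx ∂μt := by
    rw [hIu, ← hprod, lintegral_prod _ hGu]
  have hI32_it : (∫⁻ z in Ioo α β ×ˢ ball (0 : EuclideanSpace ℝ (Fin 3)) r, ‖p z.1 z.2‖ₑ ^ (3 / 2 : ℝ)) =
      ∫⁻ t, ∫⁻ x, ‖p t x‖ₑ ^ (3 / 2 : ℝ) ∂μx ∂μt := by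
    rw [← hprod, lintegral_prod _ hGp]
  have hLHS_it : (∫⁻ z in Ioo α β ×ˢ ball (0 : EuclideanSpace ℝ (Fin 3)) (r / 2), ‖p z.1 z.2‖ₑ * ‖u z.1 z.2‖ₑ) =
      ∫⁻ t, ∫⁻ x, ‖p t x‖ₑ * ‖u t x‖ₑ ∂μy ∂μt := by
    rw [← hprody, lintegral_prod _ hGpu]
  have hAu : AEMeasurable (fun t => ∫⁻ x, ‖u t x‖ₑ ^ (3 : ℕ) ∂μx) μt := hGu.lintegral_prod_right'
  have hAp : AEMeasurable (fun t => ∫⁻ x, ‖p t x‖ₑ ∂μx) μt := hGp1.lintegral_prod_right'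
  -- a.e. in time: finite slices, measurable slices, the pressure equation on the slice
  have hfp : ∀ᵐ t ∂μt, ∫⁻ x, ‖p t x‖ₑ ^ (3 / 2 : ℝ) ∂μx < ⊤ :=
    ae_lt_top' hGp.lintegral_prod_right' (by rw [← hI32_it]; exact hIpt.ne)
  have hfu : ∀ᵐ t ∂μt, ∫⁻ x, ‖u t x‖ₑ ^ (3 : ℕ) ∂μx < ⊤ :=
    ae_lt_top' hGu.lintegral_prod_right' (by rw [← hIu_it]; exact hIut.ne)
  have hmp : ∀ᵐ t ∂μt, AEStronglyMeasurable (p t) μx := by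
    filter_upwards [hpm.prodMk_left] with t ht
    exact ht
  have hmu : ∀ᵐ t ∂μt, AEStronglyMeasurable (u t) μx := by
    filter_upwards [hum.prodMk_left] with t ht
    exact ht
  have hid := hns'.ae_forall_slice_pressure_identity hf0 hdiv0
  have hSt : ∀ᵐ t ∂μt, ∫⁻ x, ‖u t x‖ₑ ∂μy ≤ S := by
    rw [hμt]
    filter_upwards [ae_restrict_mem measurableSet_Ioo] with t ht
    exact hS t ht
  -- exponent bookkeeping for the slice memberships
  have h32 : (3 / 2 : ℝ≥0∞).toReal = 3 / 2 := by rw [ENNReal.toReal_div]; norm_num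
  have h32_0 : (3 / 2 : ℝ≥0∞) ≠ 0 := by norm_num
  have h32_t : (3 / 2 : ℝ≥0∞) ≠ ⊤ := (ENNReal.div_lt_top ENNReal.ofNat_ne_top two_ne_zero).ne
  have h1le : (1 : ℝ≥0∞) ≤ 3 / 2 := by
    rw [ENNReal.le_div_iff_mul_le (Or.inl two_ne_zero) (Or.inl ENNReal.ofNat_ne_top)]; norm_num
  have h3rpow : ∀ y : ℝ≥0∞, y ^ (3 : ℝ) = y ^ (3 : ℕ) := fun y => by
    rw [show (3 : ℝ) = ((3 : ℕ) : ℝ) by norm_num, ENNReal.rpow_natCast]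
  haveI hfin : IsFiniteMeasure μx :=
    ⟨by rw [hμx, Measure.restrict_apply_univ]; exact measure_ball_lt_top⟩
  set R3 : ℝ≥0∞ := ENNReal.ofReal ((r ^ 3)⁻¹) with hR3
  -- the slice estimate, a.e. in `t ∈ (α, β)`, with `∫_{B_{r/2}}|u(t)| ≤ S` inserted
  have hslice : ∀ᵐ t ∂μt, ∫⁻ x, ‖p t x‖ₑ * ‖u t x‖ₑ ∂μy ≤
      (c₄ : ℝ≥0∞) * ((∫⁻ x, ‖u t x‖ₑ ^ (3 : ℕ) ∂μx) +
        R3 * S * ((∫⁻ x, ‖p t x‖ₑ ∂μx) +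
          ENNReal.ofReal r * (∫⁻ x, ‖u t x‖ₑ ^ (3 : ℕ) ∂μx) ^ (2 / 3 : ℝ))) := by
    filter_upwards [hfp, hfu, hmp, hmu, hid, hSt] with t hfp hfu hmp hmu hid hSt
    have hpmem : MemLp (p t) (3 / 2) μx := by
      refine ⟨hmp, ?_⟩
      rw [eLpNorm_eq_lintegral_rpow_enorm_toReal h32_0 h32_t, h32]
      exact ENNReal.rpow_lt_top_of_nonneg (by norm_num) hfp.ne
    have humem : MemLp (u t) 3 μx := by
      refine ⟨hmu, ?_⟩
      rw [eLpNorm_eq_lintegral_rpow_enorm_toReal (by norm_num) (by norm_num), ENNReal.toReal_ofNat]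
      simp_rw [h3rpow]
      exact ENNReal.rpow_lt_top_of_nonneg (by norm_num) hfu.ne
    have hp1 : LocallyIntegrableOn (p t) (Ω : Set (EuclideanSpace ℝ (Fin 3))) volume := by
      have h : IntegrableOn (p t) (ball (0 : EuclideanSpace ℝ (Fin 3)) r) volume := hpmem.integrable h1le
      exact h.locallyIntegrableOn
    have hu2 : LocallyIntegrableOn (fun x => ‖u t x‖ ^ 2) (Ω : Set (EuclideanSpace ℝ (Fin 3))) volume := by
      have h2 : MemLp (u t) 2 μx := humem.mono_exponent (by norm_num)
      have h : IntegrableOn (fun x => ‖u t x‖ ^ 2) (ball (0 : EuclideanSpace ℝ (Fin 3)) r) volume :=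
        (memLp_two_iff_integrable_sq_norm hmu).1 h2
      exact h.locallyIntegrableOn
    have hidt := hid hmu hu2 hp1
    have h1 := hc₄ 0 r (p t) (u t) hr hmp hmu hfp hfu fun ψ hψ hψc hψs => hidt ψ ⟨hψ, hψc, hψs⟩
    refine h1.trans ?_
    gcongr
  -- integrate over `t ∈ (α, β)`
  have hHolder : ∫⁻ t, (∫⁻ x, ‖u t x‖ₑ ^ (3 : ℕ) ∂μx) ^ (2 / 3 : ℝ) ∂μt ≤
      ENNReal.ofReal (β - α) ^ (1 / 3 : ℝ) * Iu ^ (2 / 3 : ℝ) := by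
    have hpq : Real.HolderConjugate (3 / 2 : ℝ) 3 := ⟨by norm_num, by norm_num, by norm_num⟩
    have h1 := ENNReal.lintegral_mul_le_Lp_mul_Lq μt hpq (hAu.pow_const (2 / 3 : ℝ))
      (aemeasurable_const (b := (1 : ℝ≥0∞)))
    simp only [Pi.mul_apply, mul_one, ENNReal.one_rpow, lintegral_const, one_mul] at h1
    refine h1.trans (le_of_eq ?_)
    have e1 : (∫⁻ t, ((∫⁻ x, ‖u t x‖ₑ ^ (3 : ℕ) ∂μx) ^ (2 / 3 : ℝ)) ^ (3 / 2 : ℝ) ∂μt) = Iu := by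
      rw [hIu_it]
      refine lintegral_congr fun t => ?_
      rw [← ENNReal.rpow_mul, show (2 / 3 : ℝ) * (3 / 2) = 1 by norm_num, ENNReal.rpow_one]
    have e2 : μt univ = ENNReal.ofReal (β - α) := by
      rw [hμt, Measure.restrict_apply_univ, Real.volume_Ioo]
    rw [e1, e2, show (1 / (3 / 2 : ℝ)) = 2 / 3 by norm_num, mul_comm]
  calc (∫⁻ z in Ioo α β ×ˢ ball (0 : EuclideanSpace ℝ (Fin 3)) (r / 2), ‖p z.1 z.2‖ₑ * ‖u z.1 z.2‖ₑ)
      = ∫⁻ t, ∫⁻ x, ‖p t x‖ₑ * ‖u t x‖ₑ ∂μy ∂μt := hLHS_it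
    _ ≤ ∫⁻ t, (c₄ : ℝ≥0∞) * ((∫⁻ x, ‖u t x‖ₑ ^ (3 : ℕ) ∂μx) +
          R3 * S * ((∫⁻ x, ‖p t x‖ₑ ∂μx) +
            ENNReal.ofReal r * (∫⁻ x, ‖u t x‖ₑ ^ (3 : ℕ) ∂μx) ^ (2 / 3 : ℝ))) ∂μt := lintegral_mono_ae hslice
    _ = (c₄ : ℝ≥0∞) * ((∫⁻ t, (∫⁻ x, ‖u t x‖ₑ ^ (3 : ℕ) ∂μx) ∂μt) +
          R3 * S * ((∫⁻ t, (∫⁻ x, ‖p t x‖ₑ ∂μx) ∂μt) +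
            ENNReal.ofReal r * ∫⁻ t, (∫⁻ x, ‖u t x‖ₑ ^ (3 : ℕ) ∂μx) ^ (2 / 3 : ℝ) ∂μt)) := by
        have hm3 : AEMeasurable (fun t => (∫⁻ x, ‖u t x‖ₑ ^ (3 : ℕ) ∂μx) ^ (2 / 3 : ℝ)) μt :=
          hAu.pow_const _
        have hm2 : AEMeasurable (fun t => (∫⁻ x, ‖p t x‖ₑ ∂μx) +
            ENNReal.ofReal r * (∫⁻ x, ‖u t x‖ₑ ^ (3 : ℕ) ∂μx) ^ (2 / 3 : ℝ)) μt :=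
          hAp.add (hm3.const_mul _)
        have hm1 : AEMeasurable (fun t => (∫⁻ x, ‖u t x‖ₑ ^ (3 : ℕ) ∂μx) +
            R3 * S * ((∫⁻ x, ‖p t x‖ₑ ∂μx) +
              ENNReal.ofReal r * (∫⁻ x, ‖u t x‖ₑ ^ (3 : ℕ) ∂μx) ^ (2 / 3 : ℝ))) μt :=
          hAu.add (hm2.const_mul _)
        rw [lintegral_const_mul'' _ hm1, lintegral_add_left' hAu, lintegral_const_mul'' _ hm2,
          lintegral_add_left' hAp, lintegral_const_mul'' _ hm3]
    _ ≤ (c₄ : ℝ≥0∞) * (Iu + R3 * S * (Ip + ENNReal.ofReal r * (ENNReal.ofReal (β - α) ^ (1 / 3 : ℝ) *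
            Iu ^ (2 / 3 : ℝ)))) := by
        rw [← hIu_it, ← hIp_it]
        gcongr
    _ = (c₄ : ℝ≥0∞) * (Iu + R3 * S * (Ip + ENNReal.ofReal r * ENNReal.ofReal (β - α) ^ (1 / 3 : ℝ) *
            Iu ^ (2 / 3 : ℝ))) := by ring

end Summit.NavierStokesRegularity.NavierStokesRegularity.Theorems.PowerGaugeEulerLiouville

end
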